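import Summits.Ventures.CertifiedManyBodySolver.Observables.StructureFactors
import Summits.Ventures.CertifiedManyBodySolver.Rows.HalfFilledTL

/-!
# M2 derived rows: `limsup m_s² ≤ (1 − 2·dlo)/4` from a TL docc floor, and `S_s(π,π) = L² · m_s²`

HONEST FRAMING (page 1): first certified bounds; not a superconductivity verdict; every number
certified or labelled float.

Two solver-free consequences of the M2 row vocabulary (`Rows/HalfFilledTL.lean`) that the M2 table uses
(speedrun `mbsolver`, seat m2-4; no numbers, no certificates in this file):

§1 `StagMagSqTLCeilingRow.of_doccLowerRow` — the Lean column of the table's `TL_ms2_U*` cells: a docc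
   LOWER certificate row `M2DoccLowerRow U u dlo` (Statement.lean) issued for a certified energy upper
   `e₀(U) ≤ u` gives the thermodynamic-limit CEILING `limsup_{L even → ∞} m_s²(L) ≤ (1 − 2·dlo)/4` on the
   squared staggered magnetisation of the half-filled torus ground states (weak-⋆ compactness of the torus
   states + `stagMagSq_le` on every even torus). ONE-SIDED: no TL floor on `m_s²` is claimed (Néel order in
   the ground state is open).
§2 ONE VOCABULARY with the stripe-rows seat (lead D-11(b)): the spin structure factor
   `Observables.spinStructureFactor L k ψ = Re ⟨ψ, 𝓢_s(q) ψ⟩ / L²` (`Observables/StructureFactors.lean`, every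
   `L`, every `k ∈ (ℤ/Lℤ)²`) and `M2.stagMagSq L ψ = Re ⟨ψ, 𝓢_A ψ⟩ / L⁴` are the SAME object at `q = (π,π)`,
   `L` even: `𝓢_s(π,π) = 𝓢_A` as operators (`spinStructureOp_piIndex`) and `S_s(π,π; ψ) = L² · m_s²(L; ψ)`
   for every vector (`spinStructureFactor_piIndex`); exact identities, no hypothesis on `ψ`.
-/

noncomputable section

namespace Summit.Ventures.CertifiedManyBodySolver

open Literature.MathematicalPhysics.QuantumLattice
open Matrix HubbardWave0 Literature.Probability.LatticeModels FermionSpinMoment ThermodynamicLimit Filter Topology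
open Literature.MathematicalPhysics.QuantumLattice.FermionTorus
open scoped ComplexOrder BigOperators

namespace M2

/-! ## §1 TL docc floor ⇒ TL `m_s²` ceiling -/

/-- **TL docc LOWER row ⇒ TL `m_s²` CEILING `(1 − 2·dlo)/4`** — the Lean column of the M2 table's
`TL_ms2_U*` cells (m2-3 `sf_derived_rows`, "derived from the TL docc floor, conditional on the energy
upper `u`"): a docc lower certificate row `M2DoccLowerRow U u dlo` issued for a certified `e₀(U) ≤ u` gives
`limsup_{L even → ∞} m_s²(L) ≤ (1 − 2 dlo)/4`. Proof: if infinitely many even tori carried a normalised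
ground state with `m_s²(L) > (1 − 2 dlo)/4 + ε`, a torus limit `ω` of them (weak-⋆ compactness,
`InfVolFermionState.exists_isTorusLimitOf_subseq`) would be a TLGS state with `ω(n_{0↑}n_{0↓}) ≥ dlo`,
while `m_s²(L) ≤ (1/4 + 1/L²)(1 − 2 d_L)` (`stagMagSq_le`) and `d_L → ω(n_{0↑}n_{0↓})`
(`torusAvgExpect_docc`) force `m_s²(L) < (1 − 2 dlo)/4 + ε` for large `L` along that subsequence.
[cite: Tasaki2020, App. A.3] [cite: BratteliRobinsonII1997, §6.2.4] -/
theorem StagMagSqTLCeilingRow.of_doccLowerRow {U : ℝ} {u dlo : ℚ}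
    (hE : energyDensity2D 1 U 1 ≤ ((u : ℚ) : ℝ)) (hl : M2DoccLowerRow U u dlo) :
    StagMagSqTLCeilingRow U ((1 - 2 * dlo) / 4) := by
  classical
  have hfloor : ∀ ω : InfVolFermionState 2, IsTLGS U ω →
      ((dlo : ℚ) : ℝ) ≤ (ω.expect ({0} : Finset (Site 2)) (doccAt0 2)).re :=
    fun ω hω => squareCorrLowerRow_iff.1 hl ω hω hE
  -- the averaged local double occupancy of a torus vector is its docc density
  have hdd : ∀ (L : ℕ) [NeZero L] (φ' : Fock (Orb (FermionTorus 2 L))),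
      (torusAvgExpect L ({0} : Finset (Site 2)) (doccAt0 2) φ').re = doccDensity L φ' := by
    intro L _ φ'
    rw [doccAt0, torusAvgExpect_docc]
    have hc : ((L : ℂ) ^ 2)⁻¹ = ((((L : ℝ) ^ 2)⁻¹ : ℝ) : ℂ) := by push_cast; rfl
    rw [hc, Complex.re_ofReal_mul, doccDensity, div_eq_inv_mul]
  by_contra hrow
  unfold StagMagSqTLCeilingRow at hrow
  push Not at hrow
  obtain ⟨ε, hε, hbad⟩ := hrow
  -- violating normalised ground states
  let Viol : (L : ℕ) → Fock (Orb (FermionTorus 2 L)) → Prop := fun L φ =>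
    ∃ (_ : NeZero L), Even L ∧ IsGroundState (hamiltonian (fermionTorusGraph 2 L) 1 U) (L ^ 2) φ ∧
      star φ ⬝ᵥ φ = 1 ∧ ((((1 - 2 * dlo) / 4 : ℚ)) : ℝ) + ε < stagMagSq L φ
  have hex : ∀ L, ∃ φ : Fock (Orb (FermionTorus 2 L)), (∃ ψ, Viol L ψ) → Viol L φ := by
    intro L
    by_cases h : ∃ ψ, Viol L ψ
    · obtain ⟨ψ, hψ⟩ := h
      exact ⟨ψ, fun _ => hψ⟩
    · exact ⟨0, fun h' => absurd h' h⟩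
  choose ψ hψ using hex
  have hseq : ∀ L₀ : ℕ, ∃ L, L₀ ≤ L ∧ ∃ φ, Viol L φ := by
    intro L₀
    obtain ⟨L, inst, hL, hev, φ, hGS, h1, hlt⟩ := hbad L₀
    exact ⟨L, hL, φ, inst, hev, hGS, h1, hlt⟩
  choose Ls hLs using hseq
  have hLst : Tendsto Ls atTop atTop := tendsto_atTop_mono (fun j => (hLs j).1) tendsto_id
  have hV : ∀ j, Viol (Ls j) (ψ (Ls j)) := fun j => hψ _ (hLs j).2
  have h1 : ∀ j, star (ψ (Ls j)) ⬝ᵥ ψ (Ls j) = 1 := fun j => by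
    obtain ⟨_, -, -, h, -⟩ := hV j
    exact h
  obtain ⟨φ, hφ, ω, hω⟩ := InfVolFermionState.exists_isTorusLimitOf_subseq ψ hLst h1
  have hTLGS : IsTLGS U ω := by
    refine ⟨Ls ∘ φ, ψ, hLst.comp hφ.tendsto_atTop, fun j => ?_, fun j => ?_, fun j => h1 (φ j), hω⟩
    · obtain ⟨_, hev, -⟩ := hV (φ j)
      exact hev
    · obtain ⟨_, -, hGS, -⟩ := hV (φ j)
      exact hGS
  set D : ℝ := (ω.expect ({0} : Finset (Site 2)) (doccAt0 2)).re with hDdef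
  have hD : ((dlo : ℚ) : ℝ) ≤ D := hfloor ω hTLGS
  have hconv : Tendsto (fun j => (torusAvgExpect (Ls (φ j)) ({0} : Finset (Site 2)) (doccAt0 2)
      (ψ (Ls (φ j)))).re) atTop (𝓝 D) :=
    (Complex.continuous_re.tendsto _).comp (hω ({0} : Finset (Site 2)) (doccAt0 2))
  have hev1 : ∀ᶠ j in atTop, D - ε / 2 <
      (torusAvgExpect (Ls (φ j)) ({0} : Finset (Site 2)) (doccAt0 2) (ψ (Ls (φ j)))).re :=
    hconv.eventually (lt_mem_nhds (by linarith))
  set c : ℝ := |1 - 2 * D + ε| with hcdef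
  have hLφ : Tendsto (fun j => (((Ls (φ j) : ℕ) : ℝ)) ^ 2) atTop atTop :=
    (tendsto_pow_atTop two_ne_zero).comp (tendsto_natCast_atTop_atTop.comp (hLst.comp hφ.tendsto_atTop))
  have hev2 : ∀ᶠ j in atTop, c / (((Ls (φ j) : ℕ) : ℝ)) ^ 2 < ε / 4 :=
    (tendsto_const_nhds.div_atTop hLφ).eventually (gt_mem_nhds (by linarith))
  obtain ⟨j, hj1, hj2⟩ := (hev1.and hev2).exists
  obtain ⟨inst, hev, hGS, h1', hlt⟩ := hV (φ j)
  set L := Ls (φ j) with hLdef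
  have hm := stagMagSq_le hev hGS.1 h1'
  rw [hdd] at hj1
  have hA : (0 : ℝ) ≤ 1 / 4 + 1 / (L : ℝ) ^ 2 := by positivity
  have step1 : (1 / 4 + 1 / (L : ℝ) ^ 2) * (1 - 2 * doccDensity L (ψ L)) ≤
      (1 / 4 + 1 / (L : ℝ) ^ 2) * (1 - 2 * D + ε) :=
    mul_le_mul_of_nonneg_left (by linarith) hA
  have step2 : (1 - 2 * D + ε) / (L : ℝ) ^ 2 ≤ c / (L : ℝ) ^ 2 :=
    div_le_div_of_nonneg_right (le_abs_self _) (by positivity)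
  have step3 : (1 / 4 + 1 / (L : ℝ) ^ 2) * (1 - 2 * D + ε) =
      (1 - 2 * D + ε) / 4 + (1 - 2 * D + ε) / (L : ℝ) ^ 2 := by ring
  push_cast at hlt
  linarith

/-! ## §2 `S_s(π,π) = L² · m_s²` on every even torus -/

/-- The antiferromagnetic momentum index `k_π = (L/2, L/2) ∈ (ℤ/Lℤ)²`, i.e. `q = (π, π)` (even `L`).
[cite: HirschPRB1985, eq. (4.7)] -/
def piIndex (L : ℕ) : TorusSite 2 L := fun _ => ((L / 2 : ℕ) : ZMod L)

/-- `FermionTorus.equivTorusSite` is `toTorusSite` (definitional unfolding used by the sum reindexing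
below). [cite: HirschPRB1985, eq. (4.7)] -/
private theorem equivTorusSite_apply'' {L : ℕ} [NeZero L] (x : FermionTorus 2 L) :
    FermionTorus.equivTorusSite x = toTorusSite x := rfl

/-- On an even torus the Bloch phase at `q = (π,π)` is the staggering sign `(−1)^{x₁+x₂}`.
[cite: HirschPRB1985, eq. (4.7)] -/
theorem blochPhase_piIndex {L : ℕ} [NeZero L] (hL : Even L) (x : FermionTorus 2 L) :
    Observables.blochPhase L (piIndex L) (toTorusSite x) = (-1 : ℂ) ^ (∑ i, (ofLex x i : ℕ)) := by
  obtain ⟨M, hM⟩ := hL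
  have hM2 : L / 2 = M := by omega
  rw [Observables.blochPhase, Observables.torusDot, Fin.sum_univ_two, Fin.sum_univ_two, toTorusSite_apply,
    toTorusSite_apply]
  simp only [piIndex, hM2]
  have h : ((M : ℕ) : ZMod L) * (((ofLex x 0 : Fin L) : ℕ) : ZMod L) +
      ((M : ℕ) : ZMod L) * (((ofLex x 1 : Fin L) : ℕ) : ZMod L) =
      ((M * ((ofLex x 0 : Fin L) : ℕ) + M * ((ofLex x 1 : Fin L) : ℕ) : ℕ) : ZMod L) := by
    push_cast; ring
  rw [h, ZMod.stdAddChar_apply, ZMod.toCircle_natCast, ← Complex.exp_pi_mul_I, ← Complex.exp_nat_mul]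
  congr 1
  have hL' : (L : ℂ) = M + M := by exact_mod_cast hM
  have hM0' : (M : ℂ) ≠ 0 := by exact_mod_cast (show M ≠ 0 by have := NeZero.ne L; omega)
  push_cast
  rw [hL']
  field_simp
  ring

/-- The staggering sign of the even sublattice is `(−1)^{x₁+x₂}`. [cite: LiebPRL1989, Theorem 2] -/
theorem stagSign_evenSublattice {L : ℕ} [NeZero L] (x : FermionTorus 2 L) :
    stagSign (evenSublattice L) x = (-1 : ℂ) ^ (∑ i, (ofLex x i : ℕ)) := by
  unfold stagSign evenSublattice
  simp only [Finset.mem_filter, Finset.mem_univ, true_and, torusStagger_apply]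
  split_ifs with h1
  · rcases Nat.even_or_odd (∑ i, (ofLex x i : ℕ)) with h | h
    · exact h.neg_one_pow.symm
    · exact absurd (h1.symm.trans h.neg_one_pow) (by decide)
  · rcases Nat.even_or_odd (∑ i, (ofLex x i : ℕ)) with h | h
    · exact absurd h.neg_one_pow h1
    · exact h.neg_one_pow.symm

/-- **`𝓢_s(π,π) = 𝓢_A` on every even torus**: m3-7's spin structure operator at `q = (π,π)` is the
staggered spin structure operator of the even sublattice. [cite: HirschPRB1985, eq. (4.7)] -/
theorem spinStructureOp_piIndex (L : ℕ) [NeZero L] (hL : Even L) :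
    Observables.spinStructureOp L (piIndex L) = stagSpinStructure (evenSublattice L) := by
  unfold Observables.spinStructureOp stagSpinStructure
  symm
  refine Fintype.sum_equiv FermionTorus.equivTorusSite _ _ fun x => ?_
  refine Fintype.sum_equiv FermionTorus.equivTorusSite _ _ fun y => ?_
  simp only [equivTorusSite_apply'', ofTorusSite_toTorusSite, blochPhase_piIndex hL, stagSign_evenSublattice,
    star_pow, star_neg, star_one]

/-- **`S_s(π,π; ψ) = L² · m_s²(L; ψ)`** for every vector `ψ` on an even torus (no hypothesis on `ψ`).
[cite: HirschPRB1985, eq. (4.7)] -/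
theorem spinStructureFactor_piIndex (L : ℕ) [NeZero L] (hL : Even L) (ψ : Fock (Orb (FermionTorus 2 L))) :
    Observables.spinStructureFactor L (piIndex L) ψ = (L : ℝ) ^ 2 * stagMagSq L ψ := by
  rw [Observables.spinStructureFactor, spinStructureOp_piIndex L hL, stagMagSq]
  have hL0 : (L : ℝ) ≠ 0 := by exact_mod_cast NeZero.ne L
  field_simp

end M2

end Summit.Ventures.CertifiedManyBodySolver

end
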